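import Mathlib
import Summits.Ventures.HodgeRepro2.T5ProfiniteDistributionMeasure
import Summits.Ventures.HodgeRepro2.T5MeasureDistribution
import Summits.Ventures.HodgeRepro2.T5PadicProductOpenSubgroups

/-!
# T5ProfiniteDistributionPadic — the presentations `ℤ_p ≅ lim_k ℤ/p^k` and
`ℤ_p^ι ≅ lim_k (ℤ/p^k)^ι`: «ℒ⁻ ∈ W[[Γ⁻]] = lim_k W[Γ⁻/p^kΓ⁻]» read in the model

Tier-5 support for route-3's §G (route/T5-CHECK-G-p7.md §3 S1 / S2 / S4, §20.2 «what stays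
prose: that the Katz branch measure is such an m»): S2 has `Γ⁻ ≅ ℤ_p^δ` and Hsieh's measure
`ℒ⁻_{χ,Σ}` lives in `W[[Γ⁻]] = lim_k W[Γ⁻/Γ⁻^{p^k}]`; the branch measure lives in
`W[[Γ_𝔭]] = lim_k W[Γ_𝔭/Γ_𝔭^{p^k}]`, `Γ_𝔭 ≅ ℤ_p`.  T5ProfiniteDistribution /
T5ProfiniteDistributionMeasure identify the bounded measures on ANY presented profinite space with
the bounded compatible systems on its levels; this file supplies the two presentations:

* `padicPresentation p : Presentation ℤ_[p]` — levels `ℤ/p^k`, level maps `toZModPow k`,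
  transition maps the casts; its fibres are T5MeasureDistribution's residue classes and its
  coordinates are T5MeasureDistribution's `dist` (`coord_padicPresentation`, by `rfl`) — the
  abstract dictionary specialises to the concrete one on `Γ_𝔭`;
* `padicProductPresentation p ι : Presentation (ι → ℤ_[p])` — levels `(ℤ/p^k)^ι`, level maps
  `toZModPow k` componentwise, fibres = the cosets of `p^k ℤ_p^ι` (`q_eq_iff_sub_mem_ballSubgroup`,
  T5PadicProductOpenSubgroups' `ballSubgroup k`), shrinking by `‖x − y‖ ≤ p^{-k}` in the sup norm;
* hence **`bijective_coord_product`** — bounded `A`-valued measures on `Γ⁻ ≅ ℤ_p^ι` ↔ bounded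
  compatible systems on `(ℤ/p^k)^ι = Γ⁻/p^kΓ⁻` (the set-level «`W[[Γ⁻]] = lim_k W[Γ⁻/p^kΓ⁻]`» of
  S2, for any complete ultrametric `A`, `W` included), **`exists_measure_product`** (every
  compatible bounded system on the finite quotients IS a measure) and
  **`muV_eq_iInf_coord_product`** (Hsieh's μ-invariant of a `W`-valued measure on `Γ⁻` as
  printed: the infimum of `v(m(U))` over the cosets `U` of the subgroups `p^kΓ⁻`).

No printed input is consumed.  §8(d): uses an L-value-free non-vanishing device: NO.
-/

namespace Summit.Ventures.HodgeRepro2.T5ProfiniteDistributionPadic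

open Summit.Ventures.HodgeRepro2.T5ProfiniteDistribution
open Summit.Ventures.HodgeRepro2.T5ProfiniteDistributionMeasure
open Summit.Ventures.HodgeRepro2.T5MeasureDistribution (resClass isClopen_resClass mem_resClass_iff)
open Summit.Ventures.HodgeRepro2.T5MuInvariantPadicCosets (mem_coset_iff_norm mem_coset_iff_toZModPow)
open Summit.Ventures.HodgeRepro2.T5PadicProductOpenSubgroups (ballSubgroup mem_ballSubgroup)
open Summit.Ventures.HodgeRepro2.T5MuInvariantDVR
open IsDiscreteValuationRing (addVal)
open Finset

variable (p : ℕ) [Fact (Nat.Prime p)]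

section Padic

/-- The presentation `ℤ_p ≅ lim_k ℤ/p^k`: levels `ℤ/p^k`, level maps `toZModPow k`, transition
maps the casts, fibres the residue classes `a + p^kℤ_p` (of diameter `p^{-k}`). -/
noncomputable def padicPresentation : Presentation ℤ_[p] where
  F k := ZMod (p ^ k)
  fintype _ := inferInstance
  decEq _ := inferInstance
  q k := PadicInt.toZModPow k
  isOpen_fiber k a := (isClopen_resClass k a).2
  res k b := (b.cast : ZMod (p ^ k))
  res_q k x := PadicInt.cast_toZModPow k (k + 1) (Nat.le_succ k) x
  surjective_q k := ZMod.ringHom_surjective (PadicInt.toZModPow k)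
  shrink ε hε := by
    obtain ⟨k, hk⟩ := PadicInt.exists_pow_neg_lt p hε
    refine ⟨k, fun x y hxy => ?_⟩
    rw [dist_eq_norm]
    exact lt_of_le_of_lt (mem_coset_iff_norm.1 (mem_coset_iff_toZModPow.2 hxy)) hk

/-- The levels of `padicPresentation p` are the `ℤ/p^k`. -/
theorem padicPresentation_F (k : ℕ) : (padicPresentation p).F k = ZMod (p ^ k) := rfl

/-- The level maps of `padicPresentation p` are the `toZModPow k`. -/
theorem padicPresentation_q (k : ℕ) (x : ℤ_[p]) :
    (padicPresentation p).q k x = PadicInt.toZModPow k x := rfl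

/-- The fibres of `padicPresentation p` are T5MeasureDistribution's residue classes. -/
theorem fiber_padicPresentation (k : ℕ) (a : ZMod (p ^ k)) :
    (padicPresentation p).fiber k a = resClass k a := rfl

variable {A : Type*} [NormedCommRing A]

/-- The coordinates of a measure on `ℤ_p` in `padicPresentation p` are T5MeasureDistribution's
`dist`: the abstract dictionary specialises to the concrete one on `Γ_𝔭 ≅ ℤ_p`. -/
theorem coord_padicPresentation (m : C(ℤ_[p], A) →ₗ[A] A) :
    (padicPresentation p).coord m = T5MeasureDistribution.dist m := rfl

end Padic

section Product

variable (ι : Type*) [Fintype ι] [DecidableEq ι]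

/-- The presentation `ℤ_p^ι ≅ lim_k (ℤ/p^k)^ι` (`Γ⁻ ≅ ℤ_p^δ ≅ lim_k Γ⁻/p^kΓ⁻`): levels `(ℤ/p^k)^ι`,
level maps `toZModPow k` componentwise, transition maps the casts, fibres the cosets of
`p^k ℤ_p^ι` (of diameter `p^{-k}` in the sup norm). -/
noncomputable def padicProductPresentation : Presentation (ι → ℤ_[p]) where
  F k := ι → ZMod (p ^ k)
  fintype _ := inferInstance
  decEq _ := inferInstance
  q k x := fun i => PadicInt.toZModPow k (x i)
  isOpen_fiber k a := by
    have : {x : ι → ℤ_[p] | (fun i => PadicInt.toZModPow k (x i)) = a} =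
        ⋂ i, (fun x : ι → ℤ_[p] => x i) ⁻¹' resClass k (a i) := by
      ext x
      simp only [Set.mem_setOf_eq, funext_iff, Set.mem_iInter, Set.mem_preimage, mem_resClass_iff]
    rw [this]
    exact isOpen_iInter_of_finite fun i => (isClopen_resClass k (a i)).2.preimage (continuous_apply i)
  res k b := fun i => ((b i).cast : ZMod (p ^ k))
  res_q k x := funext fun i => PadicInt.cast_toZModPow k (k + 1) (Nat.le_succ k) (x i)
  surjective_q k a :=
    ⟨fun i => (ZMod.ringHom_surjective (PadicInt.toZModPow k) (a i)).choose,
      funext fun i => (ZMod.ringHom_surjective (PadicInt.toZModPow k) (a i)).choose_spec⟩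
  shrink ε hε := by
    obtain ⟨k, hk⟩ := PadicInt.exists_pow_neg_lt p hε
    refine ⟨k, fun x y hxy => ?_⟩
    rw [dist_eq_norm]
    refine lt_of_le_of_lt ?_ hk
    rw [pi_norm_le_iff_of_nonneg (zpow_nonneg (Nat.cast_nonneg p) _)]
    intro i
    have hi : PadicInt.toZModPow k (x i) = PadicInt.toZModPow k (y i) := congrFun hxy i
    exact mem_coset_iff_norm.1 (mem_coset_iff_toZModPow.2 hi)

/-- The levels of `padicProductPresentation p ι` are the `(ℤ/p^k)^ι`. -/
theorem padicProductPresentation_F (k : ℕ) :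
    (padicProductPresentation p ι).F k = (ι → ZMod (p ^ k)) := rfl

/-- The level maps are `toZModPow k` componentwise. -/
theorem padicProductPresentation_q (k : ℕ) (x : ι → ℤ_[p]) :
    (padicProductPresentation p ι).q k x = fun i => PadicInt.toZModPow k (x i) := rfl

/-- Two points have the same level-`k` image iff they differ by an element of `p^k ℤ_p^ι`: the
fibres are the cosets of T5PadicProductOpenSubgroups' `ballSubgroup k` — the print's
`Γ⁻/p^kΓ⁻`. -/
theorem q_eq_iff_sub_mem_ballSubgroup (k : ℕ) (x y : ι → ℤ_[p]) :
    (padicProductPresentation p ι).q k x = (padicProductPresentation p ι).q k y ↔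
      x - y ∈ ballSubgroup (p := p) (ι := ι) k := by
  rw [mem_ballSubgroup]
  constructor
  · intro h i
    have hi : PadicInt.toZModPow k (x i) = PadicInt.toZModPow k (y i) := congrFun h i
    rw [Pi.sub_apply, ← PadicInt.ker_toZModPow k]
    exact (RingHom.sub_mem_ker_iff _).2 hi
  · intro h
    refine funext fun i => ?_
    have hi := h i
    rw [Pi.sub_apply, ← PadicInt.ker_toZModPow k] at hi
    exact (RingHom.sub_mem_ker_iff _).1 hi

/-- The fibre over `a` is the coset `x + p^k ℤ_p^ι` of any of its points. -/
theorem fiber_eq_coset (k : ℕ) (x : ι → ℤ_[p]) :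
    (padicProductPresentation p ι).fiber k ((padicProductPresentation p ι).q k x) =
      {y | y - x ∈ ballSubgroup (p := p) (ι := ι) k} := by
  ext y
  rw [Presentation.mem_fiber_iff, Set.mem_setOf_eq, q_eq_iff_sub_mem_ballSubgroup]

variable {A : Type*} [NormedCommRing A]

/-- A bounded measure on `Γ⁻ ≅ ℤ_p^ι` is determined by its values on the cosets of the `p^kΓ⁻`. -/
theorem eq_of_coord_eq_product (m₁ m₂ : C(ι → ℤ_[p], A) →ₗ[A] A) {C : ℝ} (hC : 0 ≤ C)
    (hm₁ : ∀ φ : C(ι → ℤ_[p], A), ‖m₁ φ‖ ≤ C * ‖φ‖) (hm₂ : ∀ φ : C(ι → ℤ_[p], A), ‖m₂ φ‖ ≤ C * ‖φ‖)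
    (h : ∀ (k : ℕ) (a : ι → ZMod (p ^ k)),
      (padicProductPresentation p ι).coord m₁ k a = (padicProductPresentation p ι).coord m₂ k a) :
    m₁ = m₂ :=
  (padicProductPresentation p ι).eq_of_coord_eq m₁ m₂ hC hm₁ hm₂ h

variable [IsUltrametricDist A] [CompleteSpace A]

/-- EVERY bounded compatible system on the finite quotients `(ℤ/p^k)^ι = Γ⁻/p^kΓ⁻` is the system
of coordinates of a bounded measure on `Γ⁻ ≅ ℤ_p^ι`. -/
theorem exists_measure_product (d : Distribution (padicProductPresentation p ι) A) :
    ∃ m : C(ι → ℤ_[p], A) →ₗ[A] A, (∀ φ : C(ι → ℤ_[p], A), ‖m φ‖ ≤ d.bound * ‖φ‖) ∧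
      (padicProductPresentation p ι).coord m = d.val :=
  exists_measure_of_distribution (padicProductPresentation p ι) d

variable [NormOneClass A]

/-- «`W[[Γ⁻]] = lim_k W[Γ⁻/p^kΓ⁻]`» IN THE MODEL: the bounded `A`-valued measures on `Γ⁻ ≅ ℤ_p^ι`
(bounded by `C`) are in bijection, through their values on the cosets of the `p^kΓ⁻`, with the
bounded compatible systems on the finite quotients `(ℤ/p^k)^ι` (bounded by `C`) — for any complete
ultrametric `A`, `W` included. -/
theorem bijective_coord_product {C : ℝ} (hC : 0 ≤ C) :
    Set.BijOn (fun m : C(ι → ℤ_[p], A) →ₗ[A] A => (padicProductPresentation p ι).coord m)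
      {m | ∀ φ : C(ι → ℤ_[p], A), ‖m φ‖ ≤ C * ‖φ‖}
      {v : ∀ k : ℕ, (ι → ZMod (p ^ k)) → A | (∀ (k : ℕ) (a : ι → ZMod (p ^ k)),
        v k a = ∑ b ∈ univ.filter (fun b : ι → ZMod (p ^ (k + 1)) =>
          (fun i => ((b i).cast : ZMod (p ^ k))) = a), v (k + 1) b) ∧
        ∀ (k : ℕ) (a : ι → ZMod (p ^ k)), ‖v k a‖ ≤ C} :=
  bijective_coord_on_bounded (padicProductPresentation p ι) hC

end Product

section Mu

variable (ι : Type*) [Fintype ι] [DecidableEq ι]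
variable {A : Type*} [NormedCommRing A] [IsDomain A] [IsDiscreteValuationRing A]

/-- HSIEH'S μ-INVARIANT ON `Γ⁻` AS PRINTED: for a `W`-valued measure `m` on `Γ⁻ ≅ ℤ_p^ι`,
`μ(m) = inf_U v(m(U))` over the cosets `U` of the subgroups `p^kΓ⁻` — the «inf over opens» of
T5MuInvariantDVR is attained on the standard open cosets. -/
theorem muV_eq_iInf_coord_product (m : C(ι → ℤ_[p], A) →ₗ[A] A) :
    muV m = ⨅ k : ℕ, ⨅ a : ι → ZMod (p ^ k), addVal A ((padicProductPresentation p ι).coord m k a) :=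
  (padicProductPresentation p ι).muV_eq_iInf_coord m

end Mu

end Summit.Ventures.HodgeRepro2.T5ProfiniteDistributionPadic
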